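import Literature.AlgebraicGeometry.Frobenioids.ArchimedeanClausesE
import HarnessLib

/-!
# Frobenioids II, Example 3.3 (ii): [FrdI] Def. 1.3 (v)(b)(c) for `C₀`, and `C₀ → F_{Φ₀}` is a Frobenioid

Mochizuki, *The geometry of Frobenioids II: poly-Frobenioids*, Kyushu J. Math. **62** (2008)
401–460, §3, Example 3.3 (ii), author's text p. 28 [cite: MochizukiFrdII2008, Ex 3.3 (ii) p.28];
clauses (v)(b), (v)(c) of [FrdI] Def. 1.3 (found's `Frobenioid.lean`) for abc-iut-L1-t6's
`C₀ → F_{Φ₀}`.  PROOF-ONLY file (no definition).  A pre-step `φ = (f, 1, c) : (L, B_L, λ_L) →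
(K, B_K, λ_K)` factors as
`(L, B_L, λ_L) →(𝟙,1,1)→ (L, B_L, λ_K/|c|) →(f,1,c)→ (K, B_K, λ_K)` (co-angular pre-step, then
isometric pre-step: `v_b_exists`) and as
`(L, B_L, λ_L) →(𝟙,1,c)→ (L, τ_f(B_K), |c| λ_L) →(f,1,1)→ (K, B_K, λ_K)` (isometric pre-step, then
co-angular pre-step: `v_c_exists`); both factorisations are unique up to isomorphism
(`v_b_unique`, `v_c_unique`: by Def. 1.3 (iii)(d), since `Div` of the co-angular part is `Div(φ)`,
and pre-steps are epi, resp. mono).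

Finally the ASSEMBLY: "Now a routine verification reveals that `C` satisfies the conditions of
[Mzk5], Definition 1.3, hence that `C` is a Frobenioid" (p. 28) — here for the absolute category
`C₀` over `D₀` (abc-iut-L1-t6's `ArchFrd.C0.toElem : C₀ ⥤ F_{Φ₀}`): `C0.isFrobenioid` collects the 24
clauses of found's `PreFrobenioid.IsFrobenioid` ([FrdI] Def. 1.3) proved in `ArchimedeanFrobeniusType`,
`ArchimedeanPullbacks`, `ArchimedeanClausesB`–`F`, over t6's PROVED pre-Frobenioid structure
`C0.preFrobenioidStructure_holds`.  The relative statement over a base `π : D → D₀`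
(`ArchFrd.Ex33ii_isFrobenioid π`, `C = C₀ ×_{D₀} D`) follows by [FrdI] Prop. 1.6 (ii) in
`ArchimedeanFrobenioidRelative.lean`.
-/

namespace Literature.AlgebraicGeometry.Frobenioids

open CategoryTheory Set Function Topology
open scoped Pointwise

noncomputable section

namespace ArchFrd

namespace C0

variable {X Y Z : C0}

/-! ### Def. 1.3 (v)(b) -/

/-- **Def. 1.3 (v)(b), existence, for `C₀`**: a pre-step `(f, 1, c)` is `(f, 1, c) ∘ (𝟙, 1, 1)`
through `(L, B_L, λ_K/|c|)`: a co-angular pre-step followed by an isometric pre-step.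
[cite: MochizukiFrdII2008, Ex 3.3 (ii) p.28] -/
theorem v_b_exists {A B : C0} (φ : A ⟶ B) (hφ : PreFrobenioid.IsPreStep toElem φ) :
    ∃ (X : C0) (β : A ⟶ X) (α : X ⟶ B), β ≫ α = φ ∧ PreFrobenioid.IsCoAngularPreStep toElem β ∧
      (PreFrobenioid.IsIsometry toElem α ∧ PreFrobenioid.IsPreStep toElem α) := by
  have hd : degFr φ = 1 := hφ.1
  haveI : IsIso (Base φ) := hφ.2
  have hc : 0 < ‖(scalar φ : ℂ)‖ := norm_pos_iff.mpr (scalar φ).ne_zero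
  have hle : ‖(scalar φ : ℂ)‖ * A.tip ≤ B.tip := by
    have := norm_scalar_mul_tip_pow_le φ
    rwa [hd, PNat.one_coe, pow_one] at this
  -- `X = (L, B_L, λ_K / |c|)`
  obtain ⟨R, hRd, hRt⟩ := exists_angularRegion A.region.isOpen_dir A.region.isConnected_dir
    ⟨B.tip / ‖(scalar φ : ℂ)‖, div_pos B.tip_pos hc⟩
  have hR : A.base = D0.real → R.IsIsotropic := fun h => by
    change R.dir = univ
    rw [hRd]
    exact A.isIsotropic_of_isReal h
  let X : C0 := ⟨A.base, R, hR⟩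
  -- `β = (𝟙, 1, 1)`
  obtain ⟨A₁, hA₁c, hA₁t, hA₁d, -⟩ := exists_pulledRegion X (𝟙 A.base)
  rw [twist_id_image] at hA₁d
  obtain ⟨β, hβb, hβd, hβc⟩ := exists_hom A X (𝟙 A.base) 1 (one_mem _) hA₁c
    (by rw [hA₁d, unitPart_one, one_smul, PNat.one_coe, pow_one]; exact hRd.symm.subset)
    (by
      rw [hA₁t, Units.val_one, norm_one, one_mul, PNat.one_coe, pow_one]
      change A.tip ≤ ((R.tip : PosReal) : ℝ)
      rw [hRt]
      change A.tip ≤ B.tip / ‖(scalar φ : ℂ)‖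
      rw [le_div_iff₀ hc, mul_comm]
      exact hle)
  -- `α = (f, 1, c)`
  obtain ⟨R₂, hR₂c, hR₂t, hR₂d, -⟩ := exists_pulledRegion B (Base φ)
  obtain ⟨h1, h2⟩ := hom_conditions φ hR₂c
  rw [hd, PNat.one_coe, pow_one] at h1
  obtain ⟨α, hαb, hαd, hαc⟩ := exists_hom X B φ.base 1 φ.scalar_mem hR₂c
    (by
      rw [PNat.one_coe, pow_one]
      change unitPart ℂ (scalar φ) • R.dir ⊆ R₂.dir
      rw [hRd]
      exact h1)
    (by
      rw [PNat.one_coe, pow_one, hR₂t, ← tip_eq]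
      change ‖(scalar φ : ℂ)‖ * ((R.tip : PosReal) : ℝ) ≤ B.tip
      rw [hRt]
      change ‖(scalar φ : ℂ)‖ * (B.tip / ‖(scalar φ : ℂ)‖) ≤ B.tip
      rw [mul_div_cancel₀ _ hc.ne'])
  refine ⟨X, β, α, hom_ext ?_ ?_ ?_, ⟨?_, hβd, ?_⟩, ?_, hαd, ?_⟩
  · rw [base_comp', hβb, hαb, Category.id_comp]
  · rw [degFr_comp', hβd, hαd, hd, mul_one]
  · rw [scalar_comp', hβb, hβc, hαc, hαd, PNat.one_coe, one_pow, mul_one]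
    change D0.galAct (D0.Hom.twists (𝟙 A.base)) (scalar φ) = scalar φ
    rw [D0.twists_id, D0.galAct_false]
  · refine isCoAngular_of_isNaivelyCoAngular β fun _ => ?_
    rw [image_unitPart_homImage, image_unitPart_pullRegion, hβc, unitPart_one, one_smul, hβd,
      PNat.one_coe, pow_one, hβb, twist_id_image]
    exact hRd.symm
  · rw [isBaseIso_iff, hβb]
    infer_instance
  · refine (isIsometry_iff α).2 ?_
    rw [hαc, hαd, PNat.one_coe, pow_one]
    change ‖(scalar φ : ℂ)‖ * ((R.tip : PosReal) : ℝ) = B.tip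
    rw [hRt]
    change ‖(scalar φ : ℂ)‖ * (B.tip / ‖(scalar φ : ℂ)‖) = B.tip
    rw [mul_div_cancel₀ _ hc.ne']
  · rw [isBaseIso_iff, hαb]
    exact hφ.2

/-- **Def. 1.3 (v)(b), uniqueness, for `C₀`**: the co-angular parts `β, β'` of two factorisations
have `Div(β) = Div(φ) = Div(β')`, so Def. 1.3 (iii)(d) compares them by co-angular pre-steps both
ways, mutually inverse since pre-steps are epimorphisms. [cite: MochizukiFrdII2008, Ex 3.3 (ii) p.28] -/
theorem v_b_unique {A B X X' : C0} (φ : A ⟶ B) (β : A ⟶ X) (α : X ⟶ B) (β' : A ⟶ X')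
    (α' : X' ⟶ B) (h : β ≫ α = φ) (hβ : PreFrobenioid.IsCoAngularPreStep toElem β)
    (hα : PreFrobenioid.IsIsometry toElem α ∧ PreFrobenioid.IsPreStep toElem α)
    (h' : β' ≫ α' = φ) (hβ' : PreFrobenioid.IsCoAngularPreStep toElem β')
    (hα' : PreFrobenioid.IsIsometry toElem α' ∧ PreFrobenioid.IsPreStep toElem α') :
    ∃ γ : X ≅ X', β ≫ γ.hom = β' ∧ α = γ.hom ≫ α' := by
  -- `Div(β) = Div(φ) = Div(β')`
  have hdiv : ∀ {W : C0} (b : A ⟶ W) (a : W ⟶ B), b ≫ a = φ → PreFrobenioid.IsIsometry toElem a →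
      PreFrobenioid.IsPreStep toElem a → div b = div φ := by
    intro W b a e ha hap
    have h1 := congrArg div e
    rw [div_comp, show div a = 1 from ha, one_mul, show degFr a = 1 from hap.1, PNat.one_coe,
      pow_one] at h1
    exact h1
  have e₁ := hdiv β α h hα.1 hα.2
  have e₂ := hdiv β' α' h' hα'.1 hα'.2
  obtain ⟨f, -, hβf⟩ := iii_d_under_full β β' hβ hβ' (by rw [e₁, e₂])
  obtain ⟨g, -, hβg⟩ := iii_d_under_full β' β hβ' hβ (by rw [e₁, e₂])
  haveI : Epi β := isTotallyEpimorphic.epi β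
  haveI : Epi β' := isTotallyEpimorphic.epi β'
  have hfg : f ≫ g = 𝟙 X := by
    rw [← cancel_epi β, ← Category.assoc, hβf, hβg, Category.comp_id]
  have hgf : g ≫ f = 𝟙 X' := by
    rw [← cancel_epi β', ← Category.assoc, hβg, hβf, Category.comp_id]
  refine ⟨⟨f, g, hfg, hgf⟩, hβf, ?_⟩
  rw [← cancel_epi β, h, ← Category.assoc, hβf, h']

/-! ### Def. 1.3 (v)(c) -/

/-- **Def. 1.3 (v)(c), existence, for `C₀`**: a pre-step `(f, 1, c)` is `(f, 1, 1) ∘ (𝟙, 1, c)`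
through `(L, τ_f(B_K), |c| λ_L)`: an isometric pre-step followed by a co-angular pre-step.
[cite: MochizukiFrdII2008, Ex 3.3 (ii) p.28] -/
theorem v_c_exists {A B : C0} (φ : A ⟶ B) (hφ : PreFrobenioid.IsPreStep toElem φ) :
    ∃ (X : C0) (β' : A ⟶ X) (α' : X ⟶ B), β' ≫ α' = φ ∧
      (PreFrobenioid.IsIsometry toElem β' ∧ PreFrobenioid.IsPreStep toElem β') ∧
        PreFrobenioid.IsCoAngularPreStep toElem α' := by
  have hd : degFr φ = 1 := hφ.1
  haveI : IsIso (Base φ) := hφ.2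
  have hc : 0 < ‖(scalar φ : ℂ)‖ := norm_pos_iff.mpr (scalar φ).ne_zero
  obtain ⟨R₂, hR₂c, hR₂t, hR₂d, hR₂i⟩ := exists_pulledRegion B (Base φ)
  obtain ⟨h1, h2⟩ := hom_conditions φ hR₂c
  rw [hd, PNat.one_coe, pow_one] at h1 h2
  -- `X = (L, τ_f(B_K), |c| λ_L)`
  obtain ⟨R, hRd, hRt⟩ := exists_angularRegion R₂.isOpen_dir R₂.isConnected_dir
    ⟨‖(scalar φ : ℂ)‖ * A.tip, mul_pos hc A.tip_pos⟩
  have hR : A.base = D0.real → R.IsIsotropic := fun h => by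
    change R.dir = univ
    rw [hRd]
    exact hR₂i (isNaivelyIsotropic_of_isRealObj (isRealObj_of_hom φ h))
  let X : C0 := ⟨A.base, R, hR⟩
  -- `β' = (𝟙, 1, c)`
  obtain ⟨A₁, hA₁c, hA₁t, hA₁d, -⟩ := exists_pulledRegion X (𝟙 A.base)
  rw [twist_id_image] at hA₁d
  obtain ⟨β, hβb, hβd, hβc⟩ := exists_hom A X (𝟙 A.base) 1 φ.scalar_mem hA₁c
    (by
      rw [hA₁d, PNat.one_coe, pow_one]
      change unitPart ℂ (scalar φ) • A.region.dir ⊆ R.dir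
      rw [hRd]
      exact h1)
    (by
      rw [hA₁t, PNat.one_coe, pow_one]
      change ‖(scalar φ : ℂ)‖ * A.tip ≤ ((R.tip : PosReal) : ℝ)
      rw [hRt])
  -- `α' = (f, 1, 1)`
  obtain ⟨α, hαb, hαd, hαc⟩ := exists_hom X B φ.base 1 (one_mem _) hR₂c
    (by rw [unitPart_one, one_smul, PNat.one_coe, pow_one]; exact hRd.subset)
    (by
      rw [Units.val_one, norm_one, one_mul, PNat.one_coe, pow_one]
      change ((R.tip : PosReal) : ℝ) ≤ (R₂.tip : ℝ)
      rw [hRt]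
      exact h2)
  refine ⟨X, β, α, hom_ext ?_ ?_ ?_, ⟨?_, hβd, ?_⟩, ?_, hαd, ?_⟩
  · rw [base_comp', hβb, hαb, Category.id_comp]
  · rw [degFr_comp', hβd, hαd, hd, mul_one]
  · rw [scalar_comp', hβb, hβc, hαc, hαd, map_one, one_mul, PNat.one_coe, pow_one]
  · refine (isIsometry_iff β).2 ?_
    rw [hβc, hβd, PNat.one_coe, pow_one]
    change ‖(scalar φ : ℂ)‖ * A.tip = ((R.tip : PosReal) : ℝ)
    rw [hRt]
  · rw [isBaseIso_iff, hβb]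
    infer_instance
  · refine isCoAngular_of_isNaivelyCoAngular α fun _ => ?_
    rw [image_unitPart_homImage, image_unitPart_pullRegion, hαc, unitPart_one, one_smul, hαd,
      PNat.one_coe, pow_one, hαb]
    change R.dir = _
    rw [hRd, hR₂d]
  · rw [isBaseIso_iff, hαb]
    exact hφ.2

/-- **Def. 1.3 (v)(c), uniqueness, for `C₀`**: the co-angular parts `α, α'` of two factorisations
have `Div(α) = Div(φ) = Div(α')`, so Def. 1.3 (iii)(d) compares them by co-angular pre-steps over
`B` both ways, mutually inverse since pre-steps are monomorphisms.
[cite: MochizukiFrdII2008, Ex 3.3 (ii) p.28] -/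
theorem v_c_unique {A B X X' : C0} (φ : A ⟶ B) (β : A ⟶ X) (α : X ⟶ B) (β' : A ⟶ X')
    (α' : X' ⟶ B) (h : β ≫ α = φ)
    (hβ : PreFrobenioid.IsIsometry toElem β ∧ PreFrobenioid.IsPreStep toElem β)
    (hα : PreFrobenioid.IsCoAngularPreStep toElem α) (h' : β' ≫ α' = φ)
    (hβ' : PreFrobenioid.IsIsometry toElem β' ∧ PreFrobenioid.IsPreStep toElem β')
    (hα' : PreFrobenioid.IsCoAngularPreStep toElem α') :
    ∃ γ : X ≅ X', β ≫ γ.hom = β' ∧ α = γ.hom ≫ α' := by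
  -- `Div(α) = Div(φ) = Div(α')`
  have hdiv : ∀ {W : C0} (b : A ⟶ W) (a : W ⟶ B), b ≫ a = φ → PreFrobenioid.IsIsometry toElem b →
      div a = div φ := by
    intro W b a e hb
    have h1 := congrArg div e
    rw [div_comp, show div b = 1 from hb, one_pow, mul_one] at h1
    exact h1
  have e₁ := hdiv β α h hβ.1
  have e₂ := hdiv β' α' h' hβ'.1
  obtain ⟨g, -, hgα⟩ := iii_d_over_full α α' hα hα' (by rw [e₁, e₂])
  obtain ⟨g', -, hg'α⟩ := iii_d_over_full α' α hα' hα (by rw [e₁, e₂])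
  haveI : Mono α := v_a α hα.2
  haveI : Mono α' := v_a α' hα'.2
  have hgg' : g ≫ g' = 𝟙 X := by
    rw [← cancel_mono α, Category.assoc, hg'α, hgα, Category.id_comp]
  have hg'g : g' ≫ g = 𝟙 X' := by
    rw [← cancel_mono α', Category.assoc, hgα, hg'α, Category.id_comp]
  refine ⟨⟨g, g', hgg', hg'g⟩, ?_, hgα.symm⟩
  rw [← cancel_mono α', Category.assoc, hgα, h, h']


/-- **`C₀ → F_{Φ₀}` is a Frobenioid** ([FrdII] Ex. 3.3 (ii) for the absolute angular category over
`D₀ = {Spec ℝ, Spec ℂ}`): all conditions (i)–(vii) of [FrdI] Def. 1.3 hold.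
[cite: MochizukiFrdII2008, Ex 3.3 (ii) p.28] -/
theorem isFrobenioid : PreFrobenioid.IsFrobenioid toElem where
  isPreFrobenioid := preFrobenioidStructure_holds
  i_a := i_a
  i_b := i_b
  i_c := i_c
  ii_exists := exists_isFrobeniusType
  ii_unique _ _ _ φ ψ hφ hψ hd := isFrobeniusType_unique φ ψ hφ hψ hd
  iii_a _ _ _ f g hf hg := iii_a f g hf hg
  iii_b _ _ φ hφ ψ := iii_b φ hφ ψ
  iii_c _ _ φ hφ := iii_c φ hφ
  iii_c_base _ _ φ φ' hφ hφ' hb α β β' e₁ e₂ := iii_c_base φ φ' hφ hφ' hb α β β' e₁ e₂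
  iii_d_under_full _ _ _ φ φ' hφ hφ' h := iii_d_under_full φ φ' hφ hφ' h
  iii_d_under_surj A x := iii_d_under_surj A x
  iii_d_over_full _ _ _ ψ ψ' h h' hd := iii_d_over_full ψ ψ' h h' hd
  iii_d_over_surj A x := iii_d_over_surj A x
  iv_a_exists _ _ φ := iv_a_exists φ
  iv_a_unique _ _ _ _ _ _ φ γ β α γ' β' α' h hγ hβ hα h' hγ' hβ' hα' :=
    iv_a_unique φ γ β α γ' β' α' h hγ hβ hα h' hγ' hβ' hα'
  iv_b _ _ φ h := iv_b φ h
  v_a _ _ φ h := v_a φ h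
  v_b_exists _ _ φ h := v_b_exists φ h
  v_b_unique _ _ _ _ φ β α β' α' h hβ hα h' hβ' hα' := v_b_unique φ β α β' α' h hβ hα h' hβ' hα'
  v_c_exists _ _ φ h := v_c_exists φ h
  v_c_unique _ _ _ _ φ β α β' α' h hβ hα h' hβ' hα' := v_c_unique φ β α β' α' h hβ hα h' hβ' hα'
  vi _ _ φ ψ hφ hψ hb hm := vi φ ψ hφ hψ hb hm
  vii_a := vii_a
  vii_b _ _ φ h := vii_b φ h

end C0

end ArchFrd

end

end Literature.AlgebraicGeometry.Frobenioids
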